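import Summits.ResolutionOfSingularities.ResolutionOfSingularities.Theorems.WildQuotientsSummitReductionStubPairOrbitBlowupCentreLocalLemmas
import Literature.AlgebraicGeometry.Resolution.BlowupsFlatBaseChange
import Literature.AlgebraicGeometry.Resolution.BlowupsLocal
import Literature.AlgebraicGeometry.Resolution.StalkIdealLemmas
import Literature.AlgebraicGeometry.Resolution.AdicCompletionRegular
import Literature.AlgebraicGeometry.Resolution.RegularLocalRingsFlatDescent
import HarnessLib

/-!
# `WildQuotients.SummitReduction` (stmt-ResolutionOfSingularities-16324), line `FramePerfect`, stub O3
# (`stub_pair_orbitNormalFormBlowup_chartsOverCentre`): the transfer from `X'` to the base change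
# of the blow-up along a formal model of `𝒪_{X,x}` ("completion commutes with blowing up")

Route `ResolutionOfSingularities/WildQuotients`, crux `SummitReduction`; helper file of the line
skeleton (v9–v10), stub O3 = de Jong 1996, 4.27 [C2] (the charts of the blow-up over the centre)
for `DeJong1997.QuasiSplitNormalFormPair`, coefficient-free and for orbit centres. The printed
proof computes with "the scheme `Spec k⟦u, v, t₁, …, t_{d-1}⟧/(uv - t₁ ⋯ t_s)`" blown up in
`(u, v, t₁, t₂)` (de Jong 1996, p. 76), i.e. with the blow-up BASE-CHANGED to the completed local
ring of `X` at the point `x = π(x')` of the centre; "completion and blowing up commute in a suitable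
manner" (ibid., p. 64). This file PROVES that transfer at the level needed by fields (i)/(ii) of
`QuasiSplitNormalFormPair` upstairs, for an ARBITRARY algebra `E` over the sections `Γ(X, U)` of an
affine open `U ∋ x` which is flat and bijective on all levels `Γ(X, U)/𝔭ⁿ → E/𝔭ⁿE` of the prime `𝔭`
of `x` (e.g. `E = 𝒪̂_{X,x}`, or a formal model `A⟦u, v⟧/(uv - ∏ tᵢ) ≅ 𝒪̂_{X,x}`):

* `chartsOverCentre_transfer` — for `π : X' → X`, `x' ∈ X'` over `x ∈ U` and a point `z` of
  `Spec E` over `x`, the base change `B = π⁻¹(U) ×_U Spec E → Spec E` has a point `y` over `x'` and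
  `z`, closed if `x'` is, with: `B → Spec E` a blow-up in the pulled-back centre whenever `π` is a
  blow-up (`IsBlowup.pullback_snd_of_flat`); `𝒪_{X',x'}` regular iff `𝒪_{B,y}` regular; an
  isomorphism of completions `Ξ : 𝒪̂_{X',x'} ≅ 𝒪̂_{B,y}` extending the stalk map
  `φ : 𝒪_{X',x'} → 𝒪_{B,y}` of the first projection (the C2 worker's
  `exists_localCpl_equiv_stalk_pullback_forall_of`); and the dictionary of stalk ideals
  `(π⁻¹ I)_{x'} · 𝒪_{B,y} = ((Spec E → U → X)⁻¹ I · 𝒪_B)_y` for every ideal sheaf `I` on `X`;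
* `chartsOverCentre_map_stalkIdeal_stalkCongr`, `chartsOverCentre_quotientMap_pow_bijective_of_bijective`
  — bookkeeping (stalk ideals at equal points; level-bijectivity along a bijective algebra map).

## Sources

* A. J. de Jong, *Smoothness, semi-stability and alterations*, Publ. Math. IHÉS 83 (1996), 3.4
  (p. 64: "completion and blowing up commute") and 4.27, pp. 75–76. [DeJong1996]
* A. J. de Jong, *Families of curves and alterations*, Ann. Inst. Fourier 47 (1997), proof of
  Prop. 5.11, p. 619. [DeJong1997]
* U. Görtz, T. Wedhorn, *Algebraic Geometry I*, 2nd ed. (2020), Prop. 13.91 (2) (blow-ups commute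
  with flat base change). [GortzWedhorn2020]
-/

set_option linter.dupNamespace false -- the tree's summit namespace repeats `ResolutionOfSingularities`

noncomputable section

open CategoryTheory CategoryTheory.Limits AlgebraicGeometry TopologicalSpace Topology
open Literature.AlgebraicGeometry.Resolution
open IsLocalRing Scheme.IdealSheafData

namespace Summit.ResolutionOfSingularities.ResolutionOfSingularities.Theorems

universe u

/-! ## Bookkeeping -/

/-- Moving a stalk ideal along the identification of the stalks at two equal points. [folklore] -/
theorem chartsOverCentre_map_stalkIdeal_stalkCongr {Y : Scheme.{u}} (K : Y.IdealSheafData)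
    {a b : Y} (h : a = b) :
    (stalkIdeal K a).map (Y.presheaf.stalkCongr (.of_eq h)).hom.hom = stalkIdeal K b := by
  subst h
  obtain ⟨V, hV, haV, -⟩ :=
    exists_isAffineOpen_mem_and_subset (X := Y) (x := a) (U := ⊤) (Opens.mem_top _)
  rw [stalkIdeal_eq_map_germ K ⟨V, hV⟩ haV, Ideal.map_map]
  congr 1
  rw [← CommRingCat.hom_comp, TopCat.Presheaf.stalkCongr_hom, TopCat.Presheaf.germ_stalkSpecializes]

/-- An algebra whose structure map is bijective is bijective on all levels `R/𝔞 → S/𝔞S`.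
[folklore] -/
theorem chartsOverCentre_quotientMap_bijective_of_bijective {R S : Type u} [CommRing R]
    [CommRing S] [Algebra R S] (h : Function.Bijective (algebraMap R S)) (𝔞 : Ideal R) :
    Function.Bijective (Ideal.quotientMap (𝔞.map (algebraMap R S)) (algebraMap R S)
      Ideal.le_comap_map) := by
  refine ⟨?_, Ideal.quotientMap_surjective h.2⟩
  rw [quotientMap_injective_iff_forall]
  intro a ha
  have := Ideal.comap_map_of_bijective (algebraMap R S) h (I := 𝔞)
  rw [← Ideal.mem_comap, this] at ha
  exact ha

/-! ## The transfer -/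

/-- **Transfer from `X'` to the base change of `π` along `Spec E → U ⊆ X`** ("completion and blowing
up commute in a suitable manner", de Jong 1996, p. 64; used in 4.27 to compute with the blow-up of
the formal model, p. 76). Let `π : X' → X` be locally of finite type with `X'` locally Noetherian,
`x' ∈ X'` with `x = π(x')` in the affine open `U`, and `E` a Noetherian `Γ(X, U)`-algebra, flat and
bijective on all levels `Γ(X, U)/𝔭ⁿ → E/𝔭ⁿE` of the prime `𝔭` of `x`; let `z ∈ Spec E` lie over
`x`. Then the base change `B = π⁻¹(U) ×_U Spec E` of `π` with its projection `ρ₁ : B → Spec E` has a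
point `y` over `z` (and over `x'`), closed if `x'` is closed, such that: (1) for every ideal sheaf
`I` in which `π` is a blow-up, `ρ₁` is a blow-up in the inverse image of `I` along
`Spec E → U → X` (Görtz–Wedhorn 13.91 (2), `IsBlowup.pullback_snd_of_flat`); (2) `𝒪_{X',x'}` is
regular iff `𝒪_{B,y}` is (both iff the common completion is, Matsumura 23.7); (3) the completions
are isomorphic, `Ξ : 𝒪̂_{X',x'} ≅ 𝒪̂_{B,y}`, compatibly with the stalk map `φ : 𝒪_{X',x'} → 𝒪_{B,y}`
of the first projection (`exists_localCpl_equiv_stalk_pullback_forall_of`: `Γ(X, U) → E` is bijective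
on the levels of `𝔭`); (4) for every ideal sheaf `I` on `X`, `φ` carries the stalk `(π⁻¹I 𝒪_{X'})_{x'}`
onto the stalk at `y` of the inverse image of `I` along `B → Spec E → U → X` (the pullback square).
[cite: DeJong1996, 3.4 Claim (ii) p. 64 and 4.27 p. 76] [cite: GortzWedhorn2020, Prop. 13.91 (2)] -/
theorem chartsOverCentre_transfer {X' X : Scheme.{u}} (π : X' ⟶ X) [LocallyOfFiniteType π]
    [IsLocallyNoetherian X'] (x' : X') (U : X.affineOpens) (hxU : π.base x' ∈ (U : X.Opens))
    (E : Type u) [CommRing E] [IsNoetherianRing E] [Algebra Γ(X, U) E]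
    (hflat : (algebraMap Γ(X, U) E).Flat)
    (hlev : ∀ n, Function.Bijective (Ideal.quotientMap
      (((U.2.primeIdealOf ⟨π.base x', hxU⟩).asIdeal ^ n).map (algebraMap Γ(X, U) E))
      (algebraMap Γ(X, U) E) Ideal.le_comap_map))
    (z : Spec (.of E))
    (hz : (Spec.map (CommRingCat.ofHom (algebraMap Γ(X, U) E))).base z =
      U.2.primeIdealOf ⟨π.base x', hxU⟩) :
    ∃ (B : Scheme.{u}) (ρ₁ : B ⟶ Spec (.of E)) (y : B)
      (φ : X'.presheaf.stalk x' →+* B.presheaf.stalk y)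
      (Ξ : LocalCpl (X'.presheaf.stalk x') ≃+* LocalCpl (B.presheaf.stalk y)),
      ρ₁.base y = z ∧ (IsClosed ({x'} : Set X') → IsClosed ({y} : Set B)) ∧
      (∀ I : X.IdealSheafData, IsBlowup π I →
        IsBlowup ρ₁ (I.comap (Spec.map (CommRingCat.ofHom (algebraMap Γ(X, U) E)) ≫ U.2.fromSpec))) ∧
      (IsRegularLocalRing (X'.presheaf.stalk x') ↔ IsRegularLocalRing (B.presheaf.stalk y)) ∧
      (∀ a, Ξ (algebraMap _ (LocalCpl (X'.presheaf.stalk x')) a) =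
        algebraMap _ (LocalCpl (B.presheaf.stalk y)) (φ a)) ∧
      (∀ I : X.IdealSheafData, (stalkIdeal (I.comap π) x').map φ =
        stalkIdeal ((I.comap (Spec.map (CommRingCat.ofHom (algebraMap Γ(X, U) E)) ≫
          U.2.fromSpec)).comap ρ₁) y) := by
  set D : Type u := (Γ(X, U) : Type u) with hD
  let W : Scheme.{u} := ↑(π ⁻¹ᵁ (U : X.Opens))
  let q : W ⟶ Spec (.of D) := (π ∣_ (U : X.Opens)) ≫ U.2.isoSpec.hom
  let w₀ : W := ⟨x', hxU⟩
  have hq : q.base w₀ = U.2.primeIdealOf ⟨π.base x', hxU⟩ := by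
    change U.2.isoSpec.hom.base ((π ∣_ (U : X.Opens)).base w₀) = _
    rw [IsAffineOpen.primeIdealOf]
    congr 1
    exact Subtype.ext (morphismRestrict_base_coe π U.1 w₀)
  set 𝔭 : Ideal D := (U.2.primeIdealOf ⟨π.base x', hxU⟩).asIdeal with h𝔭
  -- the point of the fibre product over `w₀` and `z`
  obtain ⟨w, hw, hwz⟩ := Scheme.Pullback.exists_preimage_pullback (f := q)
    (g := specOfAlgebra D E) w₀ z (hq.trans hz.symm)
  have h𝔫 : 𝔭.map (algebraMap D (StalkOver q w₀)) ≤ localMaxIdeal (StalkOver q w₀) :=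
    map_le_localMaxIdeal_of_le_asIdeal q w₀ (le_of_eq (by rw [hq]))
  obtain ⟨e, he⟩ := exists_localCpl_equiv_stalk_pullback_forall_of E q w₀ 𝔭 hlev h𝔫 w hw
  -- `𝒪_{X',x'} ≅ 𝒪_{W,w₀}`
  let ιW : W ⟶ X' := (π ⁻¹ᵁ (U : X.Opens)).ι
  let s₀ : X'.presheaf.stalk x' ≃+* StalkOver q w₀ := (asIso (ιW.stalkMap w₀)).commRingCatIsoToRingEquiv
  obtain ⟨E₀, hE₀⟩ := exists_localCpl_equiv_of_ringEquiv s₀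
  let φ : X'.presheaf.stalk x' →+* (pullback q (specOfAlgebra D E)).presheaf.stalk w :=
    ((pullback.fst q (specOfAlgebra D E)).stalkMap w).hom.comp
      ((W.presheaf.stalkCongr (.of_eq hw.symm)).hom.hom.comp s₀.toRingHom)
  refine ⟨pullback q (specOfAlgebra D E), pullback.snd q (specOfAlgebra D E), w, φ, E₀.trans e,
    hwz, fun hx'c => ?_, fun I hπI => ?_, ?_, fun a => ?_, fun I => ?_⟩
  · -- closedness
    refine isClosed_singleton_of_fst_eq E q w₀ 𝔭 hlev h𝔫 hw ?_
    have : ({w₀} : Set W) = Subtype.val ⁻¹' {x'} := by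
      ext v
      simp only [Set.mem_singleton_iff]
      constructor
      · rintro rfl; rfl
      · intro hv; exact Subtype.ext hv
    rw [this]
    exact hx'c.preimage continuous_subtype_val
  · -- blow-up
    have h1 := (hπI.restrict (U : X.Opens)).comp_iso U.2.isoSpec
    rw [← Scheme.IdealSheafData.comap_comp, IsAffineOpen.isoSpec_inv_ι] at h1
    haveI : Flat (specOfAlgebra D E) := Flat.SpecMap_iff.mpr hflat
    have h2 := h1.pullback_snd_of_flat (specOfAlgebra D E)
    rw [← Scheme.IdealSheafData.comap_comp] at h2
    exact h2
  · -- regularity on both sides is regularity of the common completion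
    haveI : LocallyOfFiniteType (pullback.snd q (specOfAlgebra D E)) := inferInstance
    haveI : IsLocallyNoetherian (pullback q (specOfAlgebra D E)) :=
      LocallyOfFiniteType.isLocallyNoetherian (pullback.snd q (specOfAlgebra D E))
    constructor
    · intro hreg
      haveI := hreg
      haveI := isRegularLocalRing_adicCompletion (X'.presheaf.stalk x')
      haveI : IsRegularLocalRing (LocalCpl ((pullback q (specOfAlgebra D E)).presheaf.stalk w)) :=
        IsRegularLocalRing.of_ringEquiv (E₀.trans e)
      exact IsRegularLocalRing.of_flat_of_isLocalHom _
        (LocalCpl ((pullback q (specOfAlgebra D E)).presheaf.stalk w))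
    · intro hreg
      haveI := hreg
      haveI := isRegularLocalRing_adicCompletion ((pullback q (specOfAlgebra D E)).presheaf.stalk w)
      haveI : IsRegularLocalRing (LocalCpl (X'.presheaf.stalk x')) :=
        IsRegularLocalRing.of_ringEquiv (E₀.trans e).symm
      exact IsRegularLocalRing.of_flat_of_isLocalHom _ (LocalCpl (X'.presheaf.stalk x'))
  · change e (E₀ (algebraMap _ _ a)) = _
    rw [AdicCompletion.algebraMap_apply, Algebra.algebraMap_self, RingHom.id_apply, hE₀, he]
    rfl
  · -- the stalk ideals
    have hιπ : ιW ≫ π = q ≫ U.2.fromSpec := by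
      simp only [q, ιW, Category.assoc, IsAffineOpen.isoSpec_hom_fromSpec, morphismRestrict_ι]
    have hsq : pullback.fst q (specOfAlgebra D E) ≫ ιW ≫ π =
        pullback.snd q (specOfAlgebra D E) ≫ specOfAlgebra D E ≫ U.2.fromSpec := by
      rw [hιπ, pullback.condition_assoc]
    have hK : ((I.comap π).comap ιW).comap (pullback.fst q (specOfAlgebra D E)) =
        (I.comap (specOfAlgebra D E ≫ U.2.fromSpec)).comap (pullback.snd q (specOfAlgebra D E)) := by
      simp only [← Scheme.IdealSheafData.comap_comp, hsq]
    have h2 := chartsOverCentre_map_stalkIdeal_stalkCongr ((I.comap π).comap ιW) hw.symm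
    have h1 := stalkIdeal_comap_eq_map_stalkMap ιW (I.comap π) w₀
    change _ = stalkIdeal ((I.comap (specOfAlgebra D E ≫ U.2.fromSpec)).comap
      (pullback.snd q (specOfAlgebra D E))) w
    rw [← hK, stalkIdeal_comap_eq_map_stalkMap (pullback.fst q (specOfAlgebra D E)), ← h2, h1,
      Ideal.map_map, Ideal.map_map]
    rfl

end Summit.ResolutionOfSingularities.ResolutionOfSingularities.Theorems

end
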